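import Mathlib
import Literature.NumberTheory.LFunctions.Zhang2022.SkeletonEvalRelE
import Literature.NumberTheory.LFunctions.Zhang2022.Section15EChain
import Literature.NumberTheory.LFunctions.Zhang2022.Section15ResidueInputs
import Literature.NumberTheory.LFunctions.Zhang2022.Section15RhoProductsRel
import HarnessLib

/-!
# Zhang (2022) §15 ⇒ (15.24)ᴱ: the E15 producing edge `Skeleton.Eval1524RelE e1pp c′` from the §15
# leaves at 𝔢ⱼ := `frakeE e1pp j` (RT-05 E-rethread gate; theorems only)

Topic `Literature/NumberTheory/LFunctions/Zhang2022` (Landau–Siegel audit tree; verdict-neutral).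
Y. Zhang, *Discrete mean estimates and the Landau–Siegel zero*, arXiv:2211.02515v1 (2022)
[Zhang2022LandauSiegel] — an unrefereed manuscript under adjudication; nothing here asserts or denies
its Theorems 1–2. Lane ZHANG-L, RE-TYPE RT-05 (zl-lead R-22/R-28; zl-ref-chief C1–C5; zl-deputy
E-RETHREAD GATE item E15): the §15 producer the skeleton's E-chain (`SkeletonEvalRelEEdges.
eval181RelE_of_parts`) consumes — `Skeleton.Eval1524RelE e1pp c′` (Φ₁ vs `(𝔢₁+2𝔢₂+𝔢₃)𝔞𝔓` with
`𝔢ⱼ := frakeE e1pp j`, error `ε(𝔞+1)𝔓`) from (15.6)@bChi, (15.17)@bChi, (15.22)ᴱ@inputs15ABchi and the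
u056 rate `O(1/𝓛)` (abstract hypothesis: supplied by `Ded1524.u056_rate1_of_partsRelS`/`…Rel`/`…Rp`
from u050, Lemma 15.2, Lemma 15.3 (`Lemma153RpI`), u055 (reading of record `Step15_u055RelS`), u035),
with the 𝔢-FREE residue-value inputs plugged from the tree (`ResidueValues.step15_u058_u06x_inputs15ABchi`,
`ResidueValues.calR1_rel_all`, `Ded1524.prod_rate5_of_values_rel`) exactly as in the v23 chain term
`h1524`. Composition: `eval1524_of_rates_R_gen (frakeE e1pp)` (p476765) ∘ `eq15_23_of_eq15_22_rate1_gen`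
∘ the weakening `ε𝔓 ≤ ε(𝔞+1)𝔓`. At `e1pp := e1ppj` this is the printed `Eval1524Rel c′`
(`Skeleton.eval1524RelE_e1ppj_iff`); at `e1pp := AppendixB.e1ppD` the chain of record.
Theorems only; no new claims. WHAT THIS IS NOT: a proof of any §15 leaf, nor any claim about
Theorems 1–2 of the manuscript or Landau–Siegel zeros.

## References
* Y. Zhang, arXiv:2211.02515v1 (2022), §15 (15.24) p.88. [cite: Zhang2022LandauSiegel, §15 (15.24) p.88]
-/

noncomputable section

open Complex Real ComplexConjugate
open Literature.NumberTheory.LFunctions.Zhang2022.Skeleton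
open Literature.NumberTheory.LFunctions.Zhang2022.Typed

namespace Literature.NumberTheory.LFunctions.Zhang2022.Ded1524

/-- `|x| ≤ εP` with `A, P ≥ 0`, `ε ≥ 0` gives `|x| ≤ ε(A+1)P`. [folklore] -/
private theorem rel_of_abs_E {ε A P x : ℝ} (hA : 0 ≤ A) (hP : 0 ≤ P) (hε : 0 ≤ ε)
    (h : x ≤ ε * P) : x ≤ ε * (A + 1) * P := by
  have : ε * P ≤ ε * (A + 1) * P := by nlinarith [mul_nonneg hε hP]
  linarith

/-- **E15 at the rates level**: `Skeleton.Eval1524RelE e1pp c′` from (15.6)/(15.17) (as the abstract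
`Φp`, `S` data, any coefficient reading), (15.23)ᴿ with constants `frakeE e1pp` and the product rates
`ℛ₁*ℛ₁ⱼ = (1,2,1) + O(𝓛⁻⁵)` — `eval1524_of_rates_R_gen (frakeE e1pp)` followed by `ε𝔓 ≤ ε(𝔞+1)𝔓`.
[cite: Zhang2022LandauSiegel, §15 (15.24) p.88] -/
theorem eval1524RelE_of_rates_R (e1pp : ℕ → ℂ) {c' : ℝ}
    {Φp S R : ∀ (D : ℕ) [NeZero D], DirichletCharacter ℂ D → ℕ → ℂ}
    {Rs : ∀ (D : ℕ) [NeZero D], DirichletCharacter ℂ D → ℂ}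
    (h6 : ∀ ε : ℝ, 0 < ε → ForAllLarge fun D _ χ => AssumptionA D χ →
      ‖Phi1 c' χ - ∑ p ∈ primeWindow D, Φp D χ p‖ ≤ ε * frakP D)
    (h17 : ∀ ε : ℝ, 0 < ε → ForAllLarge fun D _ χ => AssumptionA D χ → ∀ p ∈ primeWindow D,
      ‖Φp D χ p - Rs D χ * (D : ℂ) * (p : ℂ) / (Nat.totient D : ℂ) *
          ∑ j ∈ ({1, 2, 3} : Finset ℕ), R D χ j * S D χ j‖ ≤ ε * p)
    (h23RE : ∃ C : ℝ, ForAllLarge fun D _ χ => AssumptionA D χ → ∀ j ∈ ({1, 2, 3} : Finset ℕ),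
      ‖S D χ j - frakeE e1pp j * (frakA χ : ℂ) * (Nat.totient D : ℂ) / (D : ℂ)‖ ≤ C / ell D)
    (hprod : ∃ C : ℝ, ForAllLarge fun D _ χ => AssumptionA D χ →
      ‖Rs D χ * R D χ 1 - 1‖ ≤ C / ell D ^ 5 ∧ ‖Rs D χ * R D χ 2 - 2‖ ≤ C / ell D ^ 5 ∧
        ‖Rs D χ * R D χ 3 - 1‖ ≤ C / ell D ^ 5) :
    Eval1524RelE e1pp c' := by
  intro ε hε
  exact (eval1524_of_rates_R_gen (frakeE e1pp) h6 h17 h23RE hprod ε hε).mono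
    fun D _ χ _ _ hS hA => rel_of_abs_E (frakA_nonneg χ) (frakP_nonneg D) hε.le (hS hA)

/-- **E15 — the §15 producer of the E-chain** (zl-deputy E-RETHREAD GATE; the v23 chain term `h1524`
with 𝔢ⱼ := `frakeE e1pp j`): `Skeleton.Eval1524RelE e1pp c′` from the leaves (15.6)@bChi, (15.17)@bChi,
(15.22)ᴱ@inputs15ABchi and the u056 rate `‖𝓜₁(1,1;1−βⱼ)·Σ_{n∈𝒩(𝒬),n<T} − 𝔞φ(D)/D‖ ≤ C/𝓛` at
`inputs15AB` (= `Ded1524.u056_rate1_of_partsRelS c′ h15u050 (AppendixALocal.lemma152I_holds c′) h153RpI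
hnear h15u055R h15u035`, or the `…Rel`/`…Rp` variants), the 𝔢-free residue values being tree theorems.
Skeleton plug: `have h1524 : Eval1524RelE e1ppD c' := Ded1524.eval1524RelE_of_leaves e1ppD h15_6 h15_17
h15_22 (Ded1524.u056_rate1_of_partsRelS …)`. [cite: Zhang2022LandauSiegel, §15 (15.24) p.88] -/
theorem eval1524RelE_of_leaves (e1pp : ℕ → ℂ) {c' : ℝ}
    (h6 : Section15A.Eq15_6 c' Section15A.bChi) (h17 : Section15B.Eq15_17 c' Section15A.bChi)
    (h22 : Section15C.Eq15_22E e1pp c' Section15C.inputs15ABchi)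
    (h56 : ∃ C : ℝ, ForAllLarge fun D _ χ => AssumptionA D χ → ∀ j ∈ ({1, 2, 3} : Finset ℕ),
      ‖Section15C.inputs15AB.calM1 c' χ 1 1 (1 - betaJ c' D j) *
          Section15C.sumInN c' Section15C.inputs15AB χ j -
        (frakA χ : ℂ) * (Nat.totient D : ℂ) / (D : ℂ)‖ ≤ C / ell D) :
    Eval1524RelE e1pp c' :=
  eval1524RelE_of_rates_R e1pp
    (Φp := fun D _ χ p => Section15A.Phi1pOf c' χ (Section15A.bChi D χ) p)
    (S := fun D _ χ j => Section15B.calS1 c' χ (Section15A.bChi D χ) j)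
    (R := fun _ _ χ j => Section15B.calR1 c' χ j)
    (Rs := fun _ _ χ => Section15A.calR1star c' χ)
    h6 h17
    (eq15_23_of_eq15_22_rate1_gen (frakeE e1pp) c' _ h22 h56)
    (prod_rate5_of_values_rel c' (ResidueValues.step15_u058_u06x_inputs15ABchi c').1
      (ResidueValues.calR1_rel_all c'))

end Literature.NumberTheory.LFunctions.Zhang2022.Ded1524
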